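import Summits.CriticalPhenomena.PercolationContinuityZ3.Theorems.PercNearOneGluingNoHeavyLowerTailSahiCombZsumReading
import Summits.CriticalPhenomena.PercolationContinuityZ3.Theorems.PercNearOneGluingNoHeavyLowerTailSahiCombTriWAntiNestedKernel

/-!
# AN♯3 PROVED: the kernel lemma `AntiNestedKernel` holds — the ANTI-NESTED stratum of `TRI_W(2)` is an unconditional theorem

Support file of the one-cut programme (crux `NoHeavyLowerTail`, stmt-CriticalPhenomena-4575; TRI lane of cell `prim-masterthm`; seat prim-lf-1 gen 38,
memo `FROM-prim-lf-1-gen38-AN3-KERNEL.md`).  Closes the chain `AntiNestedKernel → AntiNestedChainHall → 0 ≤ triW` of `…SahiCombTriWAntiNested`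
(identity, prim-lf-1 gen 37) and `…SahiCombTriWAntiNestedKernel` (typed kernel form + counting corollary).

Setting (P5 gen 16's token system AN♯3 with its visibility design).  Two 4-chains of up-sets `F₀ ⊆ F₁ ⊆ F₂ ⊆ F₃`, `G₀ ⊆ G₁ ⊆ G₂ ⊆ G₃`; six
coefficient vectors on the demand classes `a = {s : sᶜ ∈ Σ'}` (`Σ' = (F₃\F₀)(G₃\G₀) \ (F₂\F₁)(G₂\G₁)`), `b = F₀ ∩ refl G₃`, `c = refl F₀ ∩ G₃`,
`d = F₃ ∩ refl G₀`, `e = F₂ ∩ refl G₂`, `f = refl F₂ ∩ G₂`; five level equations for the zeta combinations `Z x = zsum kx`: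
`E₁: Z a + Z b + Z c + Z d + Z f = 0` on `X₁ = F₃G₃`, `E₂: Z a + Z c + Z e = 0` on `X₂ = F₂G₃`, `E₃: Z e + Z f = 0` on `X₃ = F₁G₂ ∪ F₂G₁`,
`E₄: Z b = 0` on `X₄ = F₀G₂`, `E₅: Z b + Z f = 0` on `X₅ = F₀G₀`.

* **`FiveUpSet.antiNested_kernel_eq_zero`** — all six vectors vanish (kernel form at `P = ⊤`).  PROOF (a 12-step human proof replacing the 61-step
  machine log `prim-masterthm-p5/code16/py/an3_best_sliced.pkl`; tools: point support, C2′ `eq_zero_of_zsum_eq_zero_on`, antipodal extension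
  `zsum_ext`, and the two reading rules `diag_read₂/₃`, `zsum_ext₂` of `…SahiCombZsumReading`):
  STEP 0 (`b`): `E₄`, `E₅` give `Z f = 0` on `F₀G₀`; `E₁ − E₂ + E₃ = Z b + Z d + 2 Z f` gives `Z d = 0` on `F₀G₀`, extended to `F₀G₃` (indices of `d`
  have complements in `G₀`); `E₁ − E₂ − E₃ = Z b + Z d − 2 Z e` gives `Z e = 0` on `F₀G₂`, extended to `F₀G₃`; then `E₁ − E₂` and the point support of
  `f` (`⊆ G₂`) give `Z b = 0` on `F₀G₃`, and C2′ kills `b`.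
  STEP 1 (`a`, three diagonal readings): `E₁` on `X₁` — the foreign classes `c, d, f` have coordinates on `refl F₀ ∪ refl G₀ ∪ refl F₂`, so `a` dies
  at indices with complement outside `F₂`; then `E₂` on `X₂` (now `a` is diagonal there) kills the indices with complement outside `G₂`; the survivors
  have complements in `X₃`, where `E₁ + E₂ − E₃ = 2 Z a + 2 Z c + Z d` kills them (foreign coordinates on `refl F₀ ∪ refl G₀`).
  STEP 2 (`c`): `2 Z c + Z d = 0` on `X₃` and `Z d = 0` on `F₀G₀` give `Z c = 0` on `F₀G₀`, hence (two-class extension) `Z c = Z d = 0` on `X₃`;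
  `E₂ = Z c + Z e` on `X₂` with `Z c = 0` on `F₀G₂ ⊆ X₃` gives `Z c = Z e = 0` on `X₂`; C2′ kills `c`, then `e`.
  STEP 3 (`d, f`): `E₁ = Z d + Z f` on `X₁` with `Z d = 0` on `F₂G₀ ⊆ X₃` gives `Z d = Z f = 0` on `X₁`; C2′ kills `d` and `f`.
* **`FiveUpSet.antiNested_kernel_eq_zero_of_upperSet`** — the same inside an arbitrary up-set `P` (the restriction is free, as for RANK-Z / AN♯1);
* **`FiveUpSet.antiNestedKernel_holds : AntiNestedKernel`**, **`FiveUpSet.antiNestedChainHall_holds : AntiNestedChainHall`** (AN♯3, the four-chain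
  Hall inequality `antiNestedDemand ≤ antiNestedSupply` inside every up-set);
* **`FiveUpSet.triW_nonneg_of_antiNested_stratum`** — THE ANTI-NESTED STRATUM: `0 ≤ triW P F G` for every up-set `P` and monotone families of
  up-sets `F, G` over a two-atom index cube with `F {b} ⊆ F {a}` and `G {a} ⊆ G {b}` — unconditional (previously `triW_nonneg_of_antiNested_of_kernel`
  modulo `AntiNestedKernel`).  With the co-nested stratum (`triW_nonneg_of_pairwise_nested`) every `a = 2` configuration whose two middle fibres are
  comparable in both families is now settled.
HONEST LABEL: complete proofs, std axioms; elementary linear algebra over `ℚ` (no census input). [this work]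
-/

namespace Summit.CriticalPhenomena.PercolationContinuityZ3.Theorems

namespace FiveUpSet

open Finset

variable {α : Type} [DecidableEq α] [Fintype α]

/-! ### AN♯3, kernel form at `P = ⊤` -/

/-- **AN♯3, kernel form at `P = ⊤`.**  For chains of up-sets `F₀ ⊆ F₁ ⊆ F₂ ⊆ F₃`, `G₀ ⊆ G₁ ⊆ G₂ ⊆ G₃` of the cube `Finset α` and coefficient vectors
`ka … kf` supported on the six AN♯3 demand classes, the five level equations (P5 gen 16 visibility design `a ↦ {1,2}`, `b ↦ {1,4,5}`, `c ↦ {1,2}`,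
`d ↦ {1}`, `e ↦ {2,3}`, `f ↦ {1,3,5}`) force all six vectors to vanish. [this work] -/
theorem antiNested_kernel_eq_zero (F₀ F₁ F₂ F₃ G₀ G₁ G₂ G₃ : Finset (Finset α))
    (hF₀ : IsUpperSet (F₀ : Set (Finset α))) (hF₁ : IsUpperSet (F₁ : Set (Finset α)))
    (hF₂ : IsUpperSet (F₂ : Set (Finset α))) (hF₃ : IsUpperSet (F₃ : Set (Finset α)))
    (hG₀ : IsUpperSet (G₀ : Set (Finset α))) (hG₁ : IsUpperSet (G₁ : Set (Finset α)))
    (hG₂ : IsUpperSet (G₂ : Set (Finset α))) (hG₃ : IsUpperSet (G₃ : Set (Finset α)))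
    (hF₀₁ : F₀ ⊆ F₁) (hF₁₂ : F₁ ⊆ F₂) (hF₂₃ : F₂ ⊆ F₃) (hG₀₁ : G₀ ⊆ G₁) (hG₁₂ : G₁ ⊆ G₂) (hG₂₃ : G₂ ⊆ G₃)
    (ka kb kc kd ke kf : Finset α → ℚ)
    (hka : ∀ s, ka s ≠ 0 → sᶜ ∈ F₃ ∧ sᶜ ∉ F₀ ∧ sᶜ ∈ G₃ ∧ sᶜ ∉ G₀ ∧ ¬ (sᶜ ∈ F₂ ∧ sᶜ ∉ F₁ ∧ sᶜ ∈ G₂ ∧ sᶜ ∉ G₁))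
    (hkb : ∀ s, kb s ≠ 0 → s ∈ F₀ ∧ sᶜ ∈ G₃)
    (hkc : ∀ s, kc s ≠ 0 → sᶜ ∈ F₀ ∧ s ∈ G₃)
    (hkd : ∀ s, kd s ≠ 0 → s ∈ F₃ ∧ sᶜ ∈ G₀)
    (hke : ∀ s, ke s ≠ 0 → s ∈ F₂ ∧ sᶜ ∈ G₂)
    (hkf : ∀ s, kf s ≠ 0 → sᶜ ∈ F₂ ∧ s ∈ G₂)
    (h1 : ∀ t, t ∈ F₃ → t ∈ G₃ → zsum ka t + zsum kb t + zsum kc t + zsum kd t + zsum kf t = 0)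
    (h2 : ∀ t, t ∈ F₂ → t ∈ G₃ → zsum ka t + zsum kc t + zsum ke t = 0)
    (h3 : ∀ t, (t ∈ F₁ ∧ t ∈ G₂) ∨ (t ∈ F₂ ∧ t ∈ G₁) → zsum ke t + zsum kf t = 0)
    (h4 : ∀ t, t ∈ F₀ → t ∈ G₂ → zsum kb t = 0)
    (h5 : ∀ t, t ∈ F₀ → t ∈ G₀ → zsum kb t + zsum kf t = 0) :
    (∀ s, ka s = 0) ∧ (∀ s, kb s = 0) ∧ (∀ s, kc s = 0) ∧ (∀ s, kd s = 0) ∧ (∀ s, ke s = 0) ∧ (∀ s, kf s = 0) := by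
  -- the up-sets used as bases: `X₁ = F₃G₃`, `X₂ = F₂G₃`, `X₃ = F₁G₂ ∪ F₂G₁`, and `F₀G₃`
  have hX1 : IsUpperSet ((F₃ ∩ G₃ : Finset (Finset α)) : Set (Finset α)) := by
    rw [coe_inter]; exact hF₃.inter hG₃
  have hX2 : IsUpperSet ((F₂ ∩ G₃ : Finset (Finset α)) : Set (Finset α)) := by
    rw [coe_inter]; exact hF₂.inter hG₃
  have hX3 : IsUpperSet ((F₁ ∩ G₂ ∪ F₂ ∩ G₁ : Finset (Finset α)) : Set (Finset α)) := by
    rw [coe_union, coe_inter, coe_inter]; exact (hF₁.inter hG₂).union (hF₂.inter hG₁)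
  have hY03 : IsUpperSet ((F₀ ∩ G₃ : Finset (Finset α)) : Set (Finset α)) := by
    rw [coe_inter]; exact hF₀.inter hG₃
  -- point support of `f` (indices in `G₂`)
  have pf : ∀ t, t ∉ G₂ → zsum kf t = 0 := fun t ht => zsum_eq_zero_of_not_mem hG₂ kf (fun d hd => (hkf d hd).2) ht
  ------------------------------------------------------------------
  -- STEP 0: `b = 0`
  ------------------------------------------------------------------
  -- (0b) `Z f = 0` on `F₀G₀`
  have f00 : ∀ t, t ∈ F₀ → t ∈ G₀ → zsum kf t = 0 := by
    intro t htF htG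
    have e5 := h5 t htF htG
    rw [h4 t htF (hG₁₂ (hG₀₁ htG)), zero_add] at e5
    exact e5
  -- (0c) `Z d = 0` on `F₀G₀` (`E₁ − E₂ + E₃`)
  have d00 : ∀ t, t ∈ F₀ → t ∈ G₀ → zsum kd t = 0 := by
    intro t htF htG
    have htF₁ := hF₀₁ htF
    have htG₂ := hG₁₂ (hG₀₁ htG)
    have e1 := h1 t (hF₂₃ (hF₁₂ htF₁)) (hG₂₃ htG₂)
    have e2 := h2 t (hF₁₂ htF₁) (hG₂₃ htG₂)
    have e3 := h3 t (Or.inl ⟨htF₁, htG₂⟩)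
    have e4 := h4 t htF htG₂
    have e5 := f00 t htF htG
    linarith
  -- (0d) `Z d = 0` on `F₀G₃` (antipodal extension: indices of `d` have complements in `G₀`)
  have d03 : ∀ t, t ∈ F₀ ∩ G₃ → zsum kd t = 0 := by
    refine zsum_ext hG₀ hY03 kd (fun d hd => (hkd d hd).2) ?_
    intro t htG ht
    exact d00 t (mem_inter.1 ht).1 htG
  -- (0e) `Z e = 0` on `F₀G₂` (`E₁ − E₂ − E₃`)
  have e02 : ∀ t, t ∈ F₀ → t ∈ G₂ → zsum ke t = 0 := by
    intro t htF htG
    have htF₁ := hF₀₁ htF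
    have htG₃ := hG₂₃ htG
    have e1 := h1 t (hF₂₃ (hF₁₂ htF₁)) htG₃
    have e2 := h2 t (hF₁₂ htF₁) htG₃
    have e3 := h3 t (Or.inl ⟨htF₁, htG⟩)
    have e4 := h4 t htF htG
    have e6 := d03 t (mem_inter.2 ⟨htF, htG₃⟩)
    linarith
  -- (0f) `Z e = 0` on `F₀G₃` (antipodal extension: indices of `e` have complements in `G₂`)
  have e03 : ∀ t, t ∈ F₀ ∩ G₃ → zsum ke t = 0 := by
    refine zsum_ext hG₂ hY03 ke (fun d hd => (hke d hd).2) ?_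
    intro t htG ht
    exact e02 t (mem_inter.1 ht).1 htG
  -- (0g) `Z b = 0` on `F₀G₃` (`E₄` on `F₀G₂`; `E₁ − E₂` and the point support of `f` off `G₂`)
  have b03 : ∀ t, t ∈ F₀ → t ∈ G₃ → zsum kb t = 0 := by
    intro t htF htG
    by_cases htG₂ : t ∈ G₂
    · exact h4 t htF htG₂
    · have htF₂ := hF₁₂ (hF₀₁ htF)
      have e1 := h1 t (hF₂₃ htF₂) htG
      have e2 := h2 t htF₂ htG
      have e6 := d03 t (mem_inter.2 ⟨htF, htG⟩)
      have e7 := e03 t (mem_inter.2 ⟨htF, htG⟩)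
      have e8 := pf t htG₂
      linarith
  -- (0h) C2′ kills `b`
  have hkb0 : ∀ s, kb s = 0 := eq_zero_of_zsum_eq_zero_on hF₀ hG₃ kb hkb b03
  have zb : ∀ t, zsum kb t = 0 := fun t => by
    unfold zsum; exact Finset.sum_eq_zero fun d _ => by rw [hkb0 d, zero_mul]
  ------------------------------------------------------------------
  -- STEP 1: `a = 0` in three diagonal readings
  ------------------------------------------------------------------
  -- round 1: `E₁` on `X₁ = F₃G₃`; foreign classes `c, d, f` live on `refl F₀ ∪ refl G₀ ∪ refl F₂`
  have hA1 : ∀ u, uᶜ ∉ F₂ → ka u = 0 := by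
    have key := diag_read₃ hX1 hF₀ hG₀ hF₂ ka kc kd kf 1 1 1 1 one_ne_zero ?_ ?_ ?_ ?_ ?_
    · intro u hu
      by_cases hG : uᶜ ∈ G₀
      · by_contra h
        exact (hka u h).2.2.2.1 hG
      · exact key u (fun h => hu (hF₁₂ (hF₀₁ h))) hG hu
    · intro d hd
      obtain ⟨x1, -, x3, -, -⟩ := hka d hd
      exact mem_inter.2 ⟨x1, x3⟩
    · exact fun d hd => (hkc d hd).1
    · exact fun d hd => (hkd d hd).2
    · exact fun d hd => (hkf d hd).1
    · intro t ht
      have e1 := h1 t (mem_inter.1 ht).1 (mem_inter.1 ht).2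
      have e2 := zb t
      linarith
  -- round 2: `E₂` on `X₂ = F₂G₃` (`a` is now diagonal there); foreign classes `c, e` live on `refl F₀ ∪ refl G₂`
  have hA2 : ∀ u, uᶜ ∉ G₂ → ka u = 0 := by
    have key := diag_read₂ hX2 hF₀ hG₂ ka kc ke 1 1 1 one_ne_zero ?_ ?_ ?_ ?_
    · intro u hu
      by_cases hF : uᶜ ∈ F₀
      · by_contra h
        exact (hka u h).2.1 hF
      · exact key u hF hu
    · intro d hd
      obtain ⟨-, -, x3, -, -⟩ := hka d hd
      have x2 : dᶜ ∈ F₂ := by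
        by_contra h'
        exact hd (hA1 d h')
      exact mem_inter.2 ⟨x2, x3⟩
    · exact fun d hd => (hkc d hd).1
    · exact fun d hd => (hke d hd).2
    · intro t ht
      have e2 := h2 t (mem_inter.1 ht).1 (mem_inter.1 ht).2
      linarith
  -- round 3: `E₁ + E₂ − E₃ = 2 Z a + 2 Z c + Z d` on `X₃` (the surviving `a`-indices have complements in `X₃`)
  have hka0 : ∀ s, ka s = 0 := by
    have key := diag_read₂ hX3 hF₀ hG₀ ka kc kd 2 2 1 two_ne_zero ?_ ?_ ?_ ?_
    · intro u
      by_contra h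
      obtain ⟨-, y0, -, z0, -⟩ := hka u h
      exact h (key u y0 z0)
    · intro d hd
      obtain ⟨-, -, -, -, hno⟩ := hka d hd
      have y2 : dᶜ ∈ F₂ := by
        by_contra h'
        exact hd (hA1 d h')
      have y3 : dᶜ ∈ G₂ := by
        by_contra h'
        exact hd (hA2 d h')
      by_cases h₁ : dᶜ ∈ F₁
      · exact mem_union.2 (Or.inl (mem_inter.2 ⟨h₁, y3⟩))
      · by_cases h₂ : dᶜ ∈ G₁
        · exact mem_union.2 (Or.inr (mem_inter.2 ⟨y2, h₂⟩))
        · exact absurd ⟨y2, h₁, y3, h₂⟩ hno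
    · exact fun d hd => (hkc d hd).1
    · exact fun d hd => (hkd d hd).2
    · intro t ht
      rcases mem_union.1 ht with h' | h'
      · have htF₁ := (mem_inter.1 h').1
        have htG₂ := (mem_inter.1 h').2
        have e1 := h1 t (hF₂₃ (hF₁₂ htF₁)) (hG₂₃ htG₂)
        have e2 := h2 t (hF₁₂ htF₁) (hG₂₃ htG₂)
        have e3 := h3 t (Or.inl ⟨htF₁, htG₂⟩)
        have e4 := zb t
        linarith
      · have htF₂ := (mem_inter.1 h').1
        have htG₁ := (mem_inter.1 h').2
        have e1 := h1 t (hF₂₃ htF₂) (hG₂₃ (hG₁₂ htG₁))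
        have e2 := h2 t htF₂ (hG₂₃ (hG₁₂ htG₁))
        have e3 := h3 t (Or.inr ⟨htF₂, htG₁⟩)
        have e4 := zb t
        linarith
  have za : ∀ t, zsum ka t = 0 := fun t => by
    unfold zsum; exact Finset.sum_eq_zero fun d _ => by rw [hka0 d, zero_mul]
  ------------------------------------------------------------------
  -- STEP 2: `c = 0`, then `e = 0`
  ------------------------------------------------------------------
  -- `2 Z c + Z d = 0` on `X₃`
  have cd3 : ∀ t, t ∈ F₁ ∩ G₂ ∪ F₂ ∩ G₁ → 2 * zsum kc t + 1 * zsum kd t = 0 := by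
    intro t ht
    rcases mem_union.1 ht with h' | h'
    · have htF₁ := (mem_inter.1 h').1
      have htG₂ := (mem_inter.1 h').2
      have e1 := h1 t (hF₂₃ (hF₁₂ htF₁)) (hG₂₃ htG₂)
      have e2 := h2 t (hF₁₂ htF₁) (hG₂₃ htG₂)
      have e3 := h3 t (Or.inl ⟨htF₁, htG₂⟩)
      have e4 := zb t
      have e5 := za t
      linarith
    · have htF₂ := (mem_inter.1 h').1
      have htG₁ := (mem_inter.1 h').2
      have e1 := h1 t (hF₂₃ htF₂) (hG₂₃ (hG₁₂ htG₁))
      have e2 := h2 t htF₂ (hG₂₃ (hG₁₂ htG₁))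
      have e3 := h3 t (Or.inr ⟨htF₂, htG₁⟩)
      have e4 := zb t
      have e5 := za t
      linarith
  -- (2a) `Z c = 0` on `F₀G₀`
  have c00 : ∀ t, t ∈ F₀ → t ∈ G₀ → zsum kc t = 0 := by
    intro t htF htG
    have e := cd3 t (mem_union.2 (Or.inl (mem_inter.2 ⟨hF₀₁ htF, hG₁₂ (hG₀₁ htG)⟩)))
    have e' := d00 t htF htG
    linarith
  -- (2b) two-class extension on `X₃`: `Z c = 0` and `Z d = 0` on `X₃`
  have c3 : ∀ t, t ∈ F₁ ∩ G₂ ∪ F₂ ∩ G₁ → zsum kc t = 0 :=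
    zsum_ext₂ hX3 hF₀ hG₀ kc kd 2 1 two_ne_zero (fun d hd => (hkc d hd).1) (fun d hd => (hkd d hd).2) cd3
      (fun t _ htF htG => c00 t htF htG)
  have d3 : ∀ t, t ∈ F₁ ∩ G₂ ∪ F₂ ∩ G₁ → zsum kd t = 0 := by
    intro t ht
    have h := zsum_ext₂_right hX3 hF₀ hG₀ kc kd 2 1 two_ne_zero (fun d hd => (hkc d hd).1) (fun d hd => (hkd d hd).2) cd3
      (fun t _ htF htG => c00 t htF htG) t ht
    rwa [one_mul] at h
  -- (2c) two-class extension on `X₂` with `E₂`: `Z c = 0` and `Z e = 0` on `X₂`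
  have ce2 : ∀ t, t ∈ F₂ ∩ G₃ → 1 * zsum kc t + 1 * zsum ke t = 0 := by
    intro t ht
    have e2 := h2 t (mem_inter.1 ht).1 (mem_inter.1 ht).2
    have e5 := za t
    linarith
  have c2 : ∀ t, t ∈ F₂ ∩ G₃ → zsum kc t = 0 :=
    zsum_ext₂ hX2 hF₀ hG₂ kc ke 1 1 one_ne_zero (fun d hd => (hkc d hd).1) (fun d hd => (hke d hd).2) ce2
      (fun t _ htF htG => c3 t (mem_union.2 (Or.inl (mem_inter.2 ⟨hF₀₁ htF, htG⟩))))
  have e2' : ∀ t, t ∈ F₂ ∩ G₃ → zsum ke t = 0 := by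
    intro t ht
    have h := zsum_ext₂_right hX2 hF₀ hG₂ kc ke 1 1 one_ne_zero (fun d hd => (hkc d hd).1) (fun d hd => (hke d hd).2) ce2
      (fun t _ htF htG => c3 t (mem_union.2 (Or.inl (mem_inter.2 ⟨hF₀₁ htF, htG⟩)))) t ht
    rwa [one_mul] at h
  -- (2d) C2′ kills `c` (indices in `G₃` with complements in `F₀`; `F₀G₃ ⊆ X₂`), then `e` (indices in `F₂`, complements in `G₂`; `F₂G₂ ⊆ X₂`)
  have hkc0 : ∀ s, kc s = 0 :=
    eq_zero_of_zsum_eq_zero_on hG₃ hF₀ kc (fun d hd => ⟨(hkc d hd).2, (hkc d hd).1⟩)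
      (fun t htG htF => c2 t (mem_inter.2 ⟨hF₁₂ (hF₀₁ htF), htG⟩))
  have hke0 : ∀ s, ke s = 0 :=
    eq_zero_of_zsum_eq_zero_on hF₂ hG₂ ke hke (fun t htF htG => e2' t (mem_inter.2 ⟨htF, hG₂₃ htG⟩))
  have zc : ∀ t, zsum kc t = 0 := fun t => by
    unfold zsum; exact Finset.sum_eq_zero fun d _ => by rw [hkc0 d, zero_mul]
  ------------------------------------------------------------------
  -- STEP 3: `d = 0` and `f = 0`
  ------------------------------------------------------------------
  have df1 : ∀ t, t ∈ F₃ ∩ G₃ → 1 * zsum kd t + 1 * zsum kf t = 0 := by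
    intro t ht
    have e1 := h1 t (mem_inter.1 ht).1 (mem_inter.1 ht).2
    have e4 := zb t
    have e5 := za t
    have e6 := zc t
    linarith
  have d1 : ∀ t, t ∈ F₃ ∩ G₃ → zsum kd t = 0 :=
    zsum_ext₂ hX1 hG₀ hF₂ kd kf 1 1 one_ne_zero (fun d hd => (hkd d hd).2) (fun d hd => (hkf d hd).1) df1
      (fun t _ htG htF => d3 t (mem_union.2 (Or.inr (mem_inter.2 ⟨htF, hG₀₁ htG⟩))))
  have f1 : ∀ t, t ∈ F₃ ∩ G₃ → zsum kf t = 0 := by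
    intro t ht
    have h := zsum_ext₂_right hX1 hG₀ hF₂ kd kf 1 1 one_ne_zero (fun d hd => (hkd d hd).2) (fun d hd => (hkf d hd).1) df1
      (fun t _ htG htF => d3 t (mem_union.2 (Or.inr (mem_inter.2 ⟨htF, hG₀₁ htG⟩)))) t ht
    rwa [one_mul] at h
  have hkd0 : ∀ s, kd s = 0 :=
    eq_zero_of_zsum_eq_zero_on hF₃ hG₀ kd hkd (fun t htF htG => d1 t (mem_inter.2 ⟨htF, hG₂₃ (hG₁₂ (hG₀₁ htG))⟩))
  have hkf0 : ∀ s, kf s = 0 :=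
    eq_zero_of_zsum_eq_zero_on hG₂ hF₂ kf (fun d hd => ⟨(hkf d hd).2, (hkf d hd).1⟩)
      (fun t htG htF => f1 t (mem_inter.2 ⟨hF₂₃ htF, hG₂₃ htG⟩))
  exact ⟨hka0, hkb0, hkc0, hkd0, hke0, hkf0⟩

/-! ### Restriction to an up-set `P`, and the typed statements -/

/-- **AN♯3, kernel form inside an up-set `P`** (the restriction to `P` is free: a demand `s ∈ P` only sees supplies `t ⊇ s`, which lie in `P`).
Hypotheses literally as in `AntiNestedKernel`. [this work] -/
theorem antiNested_kernel_eq_zero_of_upperSet (P F₀ F₁ F₂ F₃ G₀ G₁ G₂ G₃ : Finset (Finset α))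
    (hP : IsUpperSet (P : Set (Finset α)))
    (hF₀ : IsUpperSet (F₀ : Set (Finset α))) (hF₁ : IsUpperSet (F₁ : Set (Finset α)))
    (hF₂ : IsUpperSet (F₂ : Set (Finset α))) (hF₃ : IsUpperSet (F₃ : Set (Finset α)))
    (hG₀ : IsUpperSet (G₀ : Set (Finset α))) (hG₁ : IsUpperSet (G₁ : Set (Finset α)))
    (hG₂ : IsUpperSet (G₂ : Set (Finset α))) (hG₃ : IsUpperSet (G₃ : Set (Finset α)))
    (hF₀₁ : F₀ ⊆ F₁) (hF₁₂ : F₁ ⊆ F₂) (hF₂₃ : F₂ ⊆ F₃) (hG₀₁ : G₀ ⊆ G₁) (hG₁₂ : G₁ ⊆ G₂) (hG₂₃ : G₂ ⊆ G₃)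
    (ka kb kc kd ke kf : Finset α → ℚ)
    (hka : ∀ s, ka s ≠ 0 → s ∈ P ∧ sᶜ ∈ ((F₃ \ F₀) ∩ (G₃ \ G₀)) \ ((F₂ \ F₁) ∩ (G₂ \ G₁)))
    (hkb : ∀ s, kb s ≠ 0 → s ∈ P ∧ s ∈ F₀ ∧ sᶜ ∈ G₃)
    (hkc : ∀ s, kc s ≠ 0 → s ∈ P ∧ sᶜ ∈ F₀ ∧ s ∈ G₃)
    (hkd : ∀ s, kd s ≠ 0 → s ∈ P ∧ s ∈ F₃ ∧ sᶜ ∈ G₀)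
    (hke : ∀ s, ke s ≠ 0 → s ∈ P ∧ s ∈ F₂ ∧ sᶜ ∈ G₂)
    (hkf : ∀ s, kf s ≠ 0 → s ∈ P ∧ sᶜ ∈ F₂ ∧ s ∈ G₂)
    (h1 : ∀ t, t ∈ P → t ∈ F₃ → t ∈ G₃ → zsum ka t + zsum kb t + zsum kc t + zsum kd t + zsum kf t = 0)
    (h2 : ∀ t, t ∈ P → t ∈ F₂ → t ∈ G₃ → zsum ka t + zsum kc t + zsum ke t = 0)
    (h3 : ∀ t, t ∈ P → (t ∈ F₁ ∧ t ∈ G₂) ∨ (t ∈ F₂ ∧ t ∈ G₁) → zsum ke t + zsum kf t = 0)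
    (h4 : ∀ t, t ∈ P → t ∈ F₀ → t ∈ G₂ → zsum kb t = 0)
    (h5 : ∀ t, t ∈ P → t ∈ F₀ → t ∈ G₀ → zsum kb t + zsum kf t = 0) :
    (∀ s, ka s = 0) ∧ (∀ s, kb s = 0) ∧ (∀ s, kc s = 0) ∧ (∀ s, kd s = 0) ∧ (∀ s, ke s = 0) ∧ (∀ s, kf s = 0) := by
  -- off `P` every combination vanishes (point support in `P`)
  have va : ∀ t, t ∉ P → zsum ka t = 0 := fun t ht => zsum_eq_zero_of_not_mem hP ka (fun d hd => (hka d hd).1) ht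
  have vb : ∀ t, t ∉ P → zsum kb t = 0 := fun t ht => zsum_eq_zero_of_not_mem hP kb (fun d hd => (hkb d hd).1) ht
  have vc : ∀ t, t ∉ P → zsum kc t = 0 := fun t ht => zsum_eq_zero_of_not_mem hP kc (fun d hd => (hkc d hd).1) ht
  have vd : ∀ t, t ∉ P → zsum kd t = 0 := fun t ht => zsum_eq_zero_of_not_mem hP kd (fun d hd => (hkd d hd).1) ht
  have ve : ∀ t, t ∉ P → zsum ke t = 0 := fun t ht => zsum_eq_zero_of_not_mem hP ke (fun d hd => (hke d hd).1) ht
  have vf : ∀ t, t ∉ P → zsum kf t = 0 := fun t ht => zsum_eq_zero_of_not_mem hP kf (fun d hd => (hkf d hd).1) ht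
  refine antiNested_kernel_eq_zero F₀ F₁ F₂ F₃ G₀ G₁ G₂ G₃ hF₀ hF₁ hF₂ hF₃ hG₀ hG₁ hG₂ hG₃ hF₀₁ hF₁₂ hF₂₃ hG₀₁ hG₁₂ hG₂₃
    ka kb kc kd ke kf ?_ (fun s hs => (hkb s hs).2) (fun s hs => (hkc s hs).2) (fun s hs => (hkd s hs).2)
    (fun s hs => (hke s hs).2) (fun s hs => (hkf s hs).2) ?_ ?_ ?_ ?_ ?_
  · intro s hs
    have h' := (hka s hs).2
    rw [mem_sdiff, mem_inter, mem_sdiff, mem_sdiff, mem_inter, mem_sdiff, mem_sdiff] at h'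
    exact ⟨h'.1.1.1, h'.1.1.2, h'.1.2.1, h'.1.2.2, fun hh => h'.2 ⟨⟨hh.1, hh.2.1⟩, hh.2.2.1, hh.2.2.2⟩⟩
  · intro t htF htG
    by_cases htP : t ∈ P
    · exact h1 t htP htF htG
    · rw [va t htP, vb t htP, vc t htP, vd t htP, vf t htP]; ring
  · intro t htF htG
    by_cases htP : t ∈ P
    · exact h2 t htP htF htG
    · rw [va t htP, vc t htP, ve t htP]; ring
  · intro t ht
    by_cases htP : t ∈ P
    · exact h3 t htP ht
    · rw [ve t htP, vf t htP]; ring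
  · intro t htF htG
    by_cases htP : t ∈ P
    · exact h4 t htP htF htG
    · exact vb t htP
  · intro t htF htG
    by_cases htP : t ∈ P
    · exact h5 t htP htF htG
    · rw [vb t htP, vf t htP]; ring

/-- **`AntiNestedKernel` HOLDS** (the typed AN♯3 kernel statement of `…SahiCombTriWAntiNestedKernel`, for every finite cube, every up-set `P` and
all pairs of 4-chains of up-sets). [this work] -/
theorem antiNestedKernel_holds : AntiNestedKernel := by
  intro α _ _ P F₀ F₁ F₂ F₃ G₀ G₁ G₂ G₃ hP hF₀ hF₁ hF₂ hF₃ hG₀ hG₁ hG₂ hG₃ hF₀₁ hF₁₂ hF₂₃ hG₀₁ hG₁₂ hG₂₃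
    ka kb kc kd ke kf hka hkb hkc hkd hke hkf E1 E2 E3 E4 E5
  exact antiNested_kernel_eq_zero_of_upperSet P F₀ F₁ F₂ F₃ G₀ G₁ G₂ G₃ hP hF₀ hF₁ hF₂ hF₃ hG₀ hG₁ hG₂ hG₃
    hF₀₁ hF₁₂ hF₂₃ hG₀₁ hG₁₂ hG₂₃ ka kb kc kd ke kf hka hkb hkc hkd hke hkf E1 E2 E3 E4 E5

/-- **AN♯3 HOLDS**: the four-chain Hall inequality `antiNestedDemand ≤ antiNestedSupply` inside every up-set `P`, for all chains of up-sets
`F₀ ⊆ F₁ ⊆ F₂ ⊆ F₃`, `G₀ ⊆ G₁ ⊆ G₂ ⊆ G₃` of a finite cube (`antiNestedChainHall_of_kernel` + `antiNestedKernel_holds`). [this work] -/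
theorem antiNestedChainHall_holds : AntiNestedChainHall :=
  antiNestedChainHall_of_kernel antiNestedKernel_holds

/-- **THE ANTI-NESTED STRATUM OF `TRI_W(2)` (unconditional).**  For every finite cube, every up-set `P`, and monotone families `F, G` of up-sets
over an index cube with exactly two atoms `a ≠ b`: if `F {b} ⊆ F {a}` and `G {a} ⊆ G {b}` (the two middle fibres are chains in OPPOSITE
directions), then `0 ≤ triW P F G`.  (`triW_nonneg_of_antiNested_of_kernel` discharged by `antiNestedKernel_holds`.) [this work] -/
theorem triW_nonneg_of_antiNested_stratum {γ : Type} [DecidableEq γ] [Fintype γ] {β : Type} [DecidableEq β] [Fintype β]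
    {a b : β} (hab : a ≠ b) (hu : (univ : Finset β) = {a, b}) (P : Finset (Finset γ)) (F G : Finset β → Finset (Finset γ))
    (hP : IsUpperSet (P : Set (Finset γ))) (hF : ∀ x, IsUpperSet (F x : Set (Finset γ))) (hG : ∀ x, IsUpperSet (G x : Set (Finset γ)))
    (hFm : Monotone F) (hGm : Monotone G) (hFba : F {b} ⊆ F {a}) (hGab : G {a} ⊆ G {b}) :
    0 ≤ triW P F G :=
  triW_nonneg_of_antiNested_of_kernel antiNestedKernel_holds hab hu P F G hP hF hG hFm hGm hFba hGab

end FiveUpSet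

end Summit.CriticalPhenomena.PercolationContinuityZ3.Theorems
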